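import Summits.AtomisticToContinuum.HydrodynamicLimit.Theorems.RelayRaceLocalityLightConeInLawSVCCountFamilyMoments

/-!
# Count families on `ℕ`: two-sided linear variance

Helper file (`--supports stmt-AtomisticToContinuum-12500`) of the line `susceptibility-variance-continuity`
of the crux `LightConeInLaw`, for the stub `stub_countLCLT` (part (b): the count variance is two-sided
linear). Pure discrete analysis, continuing `…SVCCountFamilyMoments`.

For a count family `(n+1) p(n+1) = ν g(n) p(n)` (`Σ p = 1`, `0 ≤ g ≤ 1`) whose insertion probabilities
are large and almost constant on a long initial segment — `g ≥ 1 - λ ≥ 1/2` and `|g(n+1) - g(n)| ≤ D` on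
`[0, G]`, with `ν D ≤ 1/8`, `G ≥ 4ν + 3`, `ν ≥ 32` — the variance `V = Σ p n² - (Σ p n)²` satisfies
`ν/4 ≤ V ≤ 2ν` (`countFamily_variance`). Proof: by `var_eq`, `V = ν² (E g(n)g(n+1) - (E g)²) + ν E g`;
`E g(n)g(n+1) = E g² ± (D + tail)` (`tsum_gg_le`, `tsum_gg_ge`); `0 ≤ E g² - (E g)² ≤ E (g - g(n₀))²`
(`sq_tsum_le`, `tsum_g_sq_sub_le`) and, `g` being `D`-Lipschitz on `[0, G]` (`abs_g_sub_g_le`),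
`E (g - g(n₀))² ≤ D² E (n - n₀)² + tail = D² (V + (M - n₀)²) + tail`; the tail beyond `G` is `≤ 2/ν²`
(`tail_le_of_ge`).
-/

namespace Summit.AtomisticToContinuum.HydrodynamicLimit.Theorems.LightConeInLawSVC.CountLCLT

open scoped BigOperators
open Finset

noncomputable section

variable {p g : ℕ → ℝ} {ν : ℝ}

/-! ### The Lipschitz bound on `[0, G]` -/

/-- Telescoping: `|g(a + k) - g(a)| ≤ D k` for `a + k ≤ G`. [folklore] -/
theorem abs_g_add_sub_le {G : ℕ} {D : ℝ} (hD : ∀ n, n < G → |g (n + 1) - g n| ≤ D) :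
    ∀ (a k : ℕ), a + k ≤ G → |g (a + k) - g a| ≤ D * k := by
  intro a k
  induction k with
  | zero => intro _; simp
  | succ k ih =>
      intro hk
      have h1 := ih (by omega)
      have h2 := hD (a + k) (by omega)
      rw [← add_assoc]
      calc |g (a + k + 1) - g a| = |(g (a + k + 1) - g (a + k)) + (g (a + k) - g a)| := by ring_nf
        _ ≤ |g (a + k + 1) - g (a + k)| + |g (a + k) - g a| := abs_add_le _ _
        _ ≤ D + D * k := add_le_add h2 h1
        _ = D * ((k + 1 : ℕ) : ℝ) := by push_cast; ring

/-- **`g` is `D`-Lipschitz on `[0, G]`**: `|g(a) - g(b)| ≤ D |a - b|` for `a, b ≤ G`. [folklore] -/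
theorem abs_g_sub_g_le {G : ℕ} {D : ℝ} (hD : ∀ n, n < G → |g (n + 1) - g n| ≤ D) {a b : ℕ}
    (ha : a ≤ G) (hb : b ≤ G) : |g a - g b| ≤ D * |(a : ℝ) - b| := by
  rcases le_total b a with hba | hab
  · obtain ⟨k, rfl⟩ : ∃ k, a = b + k := ⟨a - b, by omega⟩
    have h := abs_g_add_sub_le hD b k ha
    rwa [Nat.cast_add, add_sub_cancel_left, Nat.abs_cast]
  · obtain ⟨k, rfl⟩ : ∃ k, b = a + k := ⟨b - a, by omega⟩
    have h := abs_g_add_sub_le hD a k hb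
    rw [abs_sub_comm]
    rwa [Nat.cast_add, show (a : ℝ) - (a + k) = -k by ring, abs_neg, Nat.abs_cast]

/-! ### Second-moment inequalities -/

/-- A truncated decoration: `Σ p(n) e(n) = D Σ_{n<G} p(n) + Σ_k p(k+G) ≤ D + tail` for
`e = D` on `[0, G)` and `e = 1` beyond. [folklore] -/
theorem tsum_mul_ite_le (hp : ∀ n, 0 ≤ p n) (hsum : HasSum p 1) {G : ℕ} {D : ℝ} (hD0 : 0 ≤ D) :
    ∑' n, p n * (if n < G then D else 1) ≤ D + ∑' k, p (k + G) := by
  have hs : Summable fun n => p n * (if n < G then D else 1) := by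
    refine Summable.of_norm_bounded (hsum.summable.mul_left (max D 1)) fun n => ?_
    rw [Real.norm_eq_abs, abs_mul, abs_of_nonneg (hp n), mul_comm]
    refine mul_le_mul_of_nonneg_right ?_ (hp n)
    split_ifs
    · rw [abs_of_nonneg hD0]; exact le_max_left _ _
    · rw [abs_one]; exact le_max_right _ _
  rw [← hs.sum_add_tsum_nat_add G]
  have h1 : ∑ n ∈ range G, p n * (if n < G then D else 1) = D * ∑ n ∈ range G, p n := by
    rw [mul_sum]
    refine sum_congr rfl fun n hn => ?_
    rw [if_pos (mem_range.mp hn), mul_comm]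
  have h2 : ∑' k, p (k + G) * (if k + G < G then D else 1) = ∑' k, p (k + G) := by
    refine tsum_congr fun k => ?_
    rw [if_neg (by omega), mul_one]
  rw [h1, h2]
  have h3 : ∑ n ∈ range G, p n ≤ 1 := by
    have h := sum_add_tail hsum G
    have : 0 ≤ ∑' k, p (k + G) := tsum_nonneg fun k => hp _
    linarith
  nlinarith

/-- **Upper bound for `E g(n) g(n+1)`**: `≤ E g² + D + tail`. [folklore] -/
theorem tsum_gg_le (hp : ∀ n, 0 ≤ p n) (hsum : HasSum p 1)
    (hrat : ∀ n, p (n + 1) * ((n : ℝ) + 1) = ν * g n * p n) (hg0 : ∀ n, 0 ≤ g n)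
    (hg1 : ∀ n, g n ≤ 1) (hν : 0 < ν) {G : ℕ} {D : ℝ} (hD0 : 0 ≤ D)
    (hD : ∀ n, n < G → |g (n + 1) - g n| ≤ D) :
    ∑' n, p n * (g n * g (n + 1)) ≤ ∑' n, p n * g n ^ 2 + D + ∑' k, p (k + G) := by
  have hsgg : Summable fun n => p n * (g n * g (n + 1)) :=
    summable_mul_of_abs_le hp hrat hg1 hν (B := 1) fun n => by
      rw [abs_of_nonneg (mul_nonneg (hg0 n) (hg0 _))]; exact mul_le_one₀ (hg1 n) (hg0 _) (hg1 _)
  have hsg2 : Summable fun n => p n * g n ^ 2 :=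
    summable_mul_of_abs_le hp hrat hg1 hν (B := 1) fun n => by
      rw [abs_of_nonneg (sq_nonneg _)]; exact pow_le_one₀ (hg0 n) (hg1 n)
  have hse : Summable fun n => p n * (if n < G then D else 1) :=
    summable_mul_of_abs_le hp hrat hg1 hν (B := max D 1) fun n => by
      split_ifs
      · rw [abs_of_nonneg hD0]; exact le_max_left _ _
      · rw [abs_one]; exact le_max_right _ _
  have hpt : ∀ n, p n * (g n * g (n + 1)) ≤ p n * g n ^ 2 + p n * (if n < G then D else 1) := by
    intro n
    rw [← mul_add]
    refine mul_le_mul_of_nonneg_left ?_ (hp n)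
    have hη : g (n + 1) ≤ g n + (if n < G then D else 1) := by
      split_ifs with h
      · linarith [(abs_le.mp (hD n h)).2]
      · linarith [hg1 (n + 1), hg0 n]
    calc g n * g (n + 1) ≤ g n * (g n + (if n < G then D else 1)) := mul_le_mul_of_nonneg_left hη (hg0 n)
      _ = g n ^ 2 + g n * (if n < G then D else 1) := by ring
      _ ≤ g n ^ 2 + 1 * (if n < G then D else 1) := by
          have h2 : (0 : ℝ) ≤ (if n < G then D else 1) := by split_ifs; exacts [hD0, zero_le_one]
          exact add_le_add_right (mul_le_mul_of_nonneg_right (hg1 n) h2) _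
      _ = g n ^ 2 + (if n < G then D else 1) := by rw [one_mul]
  calc ∑' n, p n * (g n * g (n + 1)) ≤ ∑' n, (p n * g n ^ 2 + p n * (if n < G then D else 1)) :=
        hsgg.tsum_le_tsum hpt (hsg2.add hse)
    _ = ∑' n, p n * g n ^ 2 + ∑' n, p n * (if n < G then D else 1) := hsg2.tsum_add hse
    _ ≤ ∑' n, p n * g n ^ 2 + (D + ∑' k, p (k + G)) := by
        gcongr; exact tsum_mul_ite_le hp hsum hD0
    _ = _ := by ring

/-- **Lower bound for `E g(n) g(n+1)`**: `≥ E g² - D - tail`. [folklore] -/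
theorem tsum_gg_ge (hp : ∀ n, 0 ≤ p n) (hsum : HasSum p 1)
    (hrat : ∀ n, p (n + 1) * ((n : ℝ) + 1) = ν * g n * p n) (hg0 : ∀ n, 0 ≤ g n)
    (hg1 : ∀ n, g n ≤ 1) (hν : 0 < ν) {G : ℕ} {D : ℝ} (hD0 : 0 ≤ D)
    (hD : ∀ n, n < G → |g (n + 1) - g n| ≤ D) :
    ∑' n, p n * g n ^ 2 - D - ∑' k, p (k + G) ≤ ∑' n, p n * (g n * g (n + 1)) := by
  have hsgg : Summable fun n => p n * (g n * g (n + 1)) :=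
    summable_mul_of_abs_le hp hrat hg1 hν (B := 1) fun n => by
      rw [abs_of_nonneg (mul_nonneg (hg0 n) (hg0 _))]; exact mul_le_one₀ (hg1 n) (hg0 _) (hg1 _)
  have hsg2 : Summable fun n => p n * g n ^ 2 :=
    summable_mul_of_abs_le hp hrat hg1 hν (B := 1) fun n => by
      rw [abs_of_nonneg (sq_nonneg _)]; exact pow_le_one₀ (hg0 n) (hg1 n)
  have hse : Summable fun n => p n * (if n < G then D else 1) :=
    summable_mul_of_abs_le hp hrat hg1 hν (B := max D 1) fun n => by
      split_ifs
      · rw [abs_of_nonneg hD0]; exact le_max_left _ _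
      · rw [abs_one]; exact le_max_right _ _
  have hpt : ∀ n, p n * g n ^ 2 - p n * (if n < G then D else 1) ≤ p n * (g n * g (n + 1)) := by
    intro n
    rw [← mul_sub]
    refine mul_le_mul_of_nonneg_left ?_ (hp n)
    have hη : g n - (if n < G then D else 1) ≤ g (n + 1) := by
      split_ifs with h
      · linarith [(abs_le.mp (hD n h)).1]
      · linarith [hg1 n, hg0 (n + 1)]
    have h1 : g n * (g n - (if n < G then D else 1)) ≤ g n * g (n + 1) := mul_le_mul_of_nonneg_left hη (hg0 n)
    have h2 : (0 : ℝ) ≤ (if n < G then D else 1) := by split_ifs; exacts [hD0, zero_le_one]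
    nlinarith [hg1 n, hg0 n]
  calc ∑' n, p n * g n ^ 2 - D - ∑' k, p (k + G) ≤ ∑' n, p n * g n ^ 2 - ∑' n, p n * (if n < G then D else 1) := by
        linarith [tsum_mul_ite_le hp hsum hD0 (G := G)]
    _ = ∑' n, (p n * g n ^ 2 - p n * (if n < G then D else 1)) := (hsg2.tsum_sub hse).symm
    _ ≤ ∑' n, p n * (g n * g (n + 1)) := (hsg2.sub hse).tsum_le_tsum hpt hsgg

/-- **Expansion of a quadratic moment**: `Σ p (h - c)² = Σ p h² - 2c Σ p h + c²` for a bounded `h`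
(`Σ p = 1`). [folklore] -/
theorem tsum_mul_sub_sq (hp : ∀ n, 0 ≤ p n) (hsum : HasSum p 1)
    (hrat : ∀ n, p (n + 1) * ((n : ℝ) + 1) = ν * g n * p n) (hg1 : ∀ n, g n ≤ 1) (hν : 0 < ν)
    {h : ℕ → ℝ} {C : ℝ} (hh : ∀ n, |h n| ≤ C * ((n : ℝ) + 1)) (c : ℝ) :
    ∑' n, p n * (h n - c) ^ 2 = ∑' n, p n * h n ^ 2 - 2 * c * ∑' n, p n * h n + c ^ 2 := by
  have hC : 0 ≤ C := by
    have h0 := hh 0; simp only [Nat.cast_zero, zero_add, mul_one] at h0; exact (abs_nonneg _).trans h0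
  have hs1 : Summable fun n => p n * h n :=
    summable_mul_of_le hp hrat hg1 hν (C := C) fun n => by
      have hn0 : (0 : ℝ) ≤ n := Nat.cast_nonneg n
      calc |h n| ≤ C * ((n : ℝ) + 1) := hh n
        _ ≤ C * ((n : ℝ) + 1) ^ 2 := by gcongr; nlinarith
  have hs2 : Summable fun n => p n * h n ^ 2 :=
    summable_mul_of_le hp hrat hg1 hν (C := C ^ 2) fun n => by
      rw [abs_of_nonneg (sq_nonneg _), ← mul_pow, ← sq_abs]
      exact pow_le_pow_left₀ (abs_nonneg _) (hh n) 2
  have hexp : ∀ n, p n * (h n - c) ^ 2 = (p n * h n ^ 2 - 2 * c * (p n * h n)) + c ^ 2 * p n := by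
    intro n; ring
  rw [tsum_congr hexp, ((hs2.sub (hs1.mul_left (2 * c))).tsum_add (hsum.summable.mul_left (c ^ 2))),
    hs2.tsum_sub (hs1.mul_left (2 * c)), tsum_mul_left, tsum_mul_left, hsum.tsum_eq]
  ring

/-- **Jensen**: `(Σ p g)² ≤ Σ p g²`. [folklore] -/
theorem sq_tsum_le (hp : ∀ n, 0 ≤ p n) (hsum : HasSum p 1)
    (hrat : ∀ n, p (n + 1) * ((n : ℝ) + 1) = ν * g n * p n) (hg0 : ∀ n, 0 ≤ g n)
    (hg1 : ∀ n, g n ≤ 1) (hν : 0 < ν) : (∑' n, p n * g n) ^ 2 ≤ ∑' n, p n * g n ^ 2 := by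
  have hh : ∀ n, |g n| ≤ 1 * ((n : ℝ) + 1) := fun n => by
    have hn0 : (0 : ℝ) ≤ n := Nat.cast_nonneg n
    rw [abs_of_nonneg (hg0 n)]; linarith [hg1 n]
  have h := tsum_mul_sub_sq hp hsum hrat hg1 hν hh (∑' n, p n * g n)
  have h0 : 0 ≤ ∑' n, p n * (g n - ∑' k, p k * g k) ^ 2 := tsum_nonneg fun n => mul_nonneg (hp n) (sq_nonneg _)
  nlinarith

/-- **The variance of `g` is at most its second moment about `g(n₀)`**, which is
`≤ D² Σ p (n - n₀)² + tail` by the Lipschitz bound on `[0, G]` (`n₀ ≤ G`). [folklore] -/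
theorem tsum_g_sq_sub_le (hp : ∀ n, 0 ≤ p n) (hsum : HasSum p 1)
    (hrat : ∀ n, p (n + 1) * ((n : ℝ) + 1) = ν * g n * p n) (hg0 : ∀ n, 0 ≤ g n)
    (hg1 : ∀ n, g n ≤ 1) (hν : 0 < ν) {G : ℕ} {D : ℝ}
    (hD : ∀ n, n < G → |g (n + 1) - g n| ≤ D) {n₀ : ℕ} (hn₀ : n₀ ≤ G) :
    ∑' n, p n * g n ^ 2 - (∑' n, p n * g n) ^ 2 ≤
      D ^ 2 * ∑' n, p n * ((n : ℝ) - n₀) ^ 2 + ∑' k, p (k + G) := by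
  have hh : ∀ n, |g n| ≤ 1 * ((n : ℝ) + 1) := fun n => by
    have hn0 : (0 : ℝ) ≤ n := Nat.cast_nonneg n
    rw [abs_of_nonneg (hg0 n)]; linarith [hg1 n]
  have hexp := tsum_mul_sub_sq hp hsum hrat hg1 hν hh (g n₀)
  -- `Var g ≤ Σ p (g - g n₀)²`
  have h1 : ∑' n, p n * g n ^ 2 - (∑' n, p n * g n) ^ 2 ≤ ∑' n, p n * (g n - g n₀) ^ 2 := by
    rw [hexp]; nlinarith [sq_nonneg (∑' n, p n * g n - g n₀)]
  refine h1.trans ?_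
  -- pointwise Lipschitz bound plus the crude bound `1` beyond `G`
  have hsq : Summable fun n => p n * ((n : ℝ) - n₀) ^ 2 :=
    summable_mul_of_le hp hrat hg1 hν (C := ((n₀ : ℝ) + 1) ^ 2) fun n => by
      have hn0 : (0 : ℝ) ≤ n := Nat.cast_nonneg n
      have hm0 : (0 : ℝ) ≤ n₀ := Nat.cast_nonneg n₀
      rw [abs_of_nonneg (sq_nonneg _), ← mul_pow]
      have : |(n : ℝ) - n₀| ≤ ((n₀ : ℝ) + 1) * ((n : ℝ) + 1) := by
        rw [abs_le]; constructor <;> nlinarith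
      calc ((n : ℝ) - n₀) ^ 2 = |(n : ℝ) - n₀| ^ 2 := (sq_abs _).symm
        _ ≤ (((n₀ : ℝ) + 1) * ((n : ℝ) + 1)) ^ 2 := pow_le_pow_left₀ (abs_nonneg _) this 2
  have hsd : Summable fun n => p n * (g n - g n₀) ^ 2 :=
    summable_mul_of_abs_le hp hrat hg1 hν (B := 1) fun n => by
      rw [abs_of_nonneg (sq_nonneg _)]
      have : |g n - g n₀| ≤ 1 := by rw [abs_le]; constructor <;> linarith [hg0 n, hg1 n, hg0 n₀, hg1 n₀]
      calc (g n - g n₀) ^ 2 = |g n - g n₀| ^ 2 := (sq_abs _).symm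
        _ ≤ 1 ^ 2 := pow_le_pow_left₀ (abs_nonneg _) this 2
        _ = 1 := one_pow 2
  have hse : Summable fun n => p n * (if n < G then (0 : ℝ) else 1) :=
    summable_mul_of_abs_le hp hrat hg1 hν (B := 1) fun n => by split_ifs <;> simp
  have hpt : ∀ n, p n * (g n - g n₀) ^ 2 ≤ D ^ 2 * (p n * ((n : ℝ) - n₀) ^ 2) + p n * (if n < G then (0 : ℝ) else 1) := by
    intro n
    have e : D ^ 2 * (p n * ((n : ℝ) - n₀) ^ 2) + p n * (if n < G then (0 : ℝ) else 1) =
        p n * (D ^ 2 * ((n : ℝ) - n₀) ^ 2 + (if n < G then (0 : ℝ) else 1)) := by ring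
    rw [e]
    refine mul_le_mul_of_nonneg_left ?_ (hp n)
    split_ifs with h
    · have hL := abs_g_sub_g_le hD h.le hn₀
      rw [add_zero, ← mul_pow]
      calc (g n - g n₀) ^ 2 = |g n - g n₀| ^ 2 := (sq_abs _).symm
        _ ≤ (D * |(n : ℝ) - n₀|) ^ 2 := pow_le_pow_left₀ (abs_nonneg _) hL 2
        _ = (D * ((n : ℝ) - n₀)) ^ 2 := by rw [mul_pow, mul_pow, sq_abs]
    · have : |g n - g n₀| ≤ 1 := by rw [abs_le]; constructor <;> linarith [hg0 n, hg1 n, hg0 n₀, hg1 n₀]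
      calc (g n - g n₀) ^ 2 = |g n - g n₀| ^ 2 := (sq_abs _).symm
        _ ≤ 1 ^ 2 := pow_le_pow_left₀ (abs_nonneg _) this 2
        _ ≤ D ^ 2 * ((n : ℝ) - n₀) ^ 2 + 1 := by rw [one_pow]; linarith [mul_nonneg (sq_nonneg D) (sq_nonneg ((n : ℝ) - n₀))]
  have htail : ∑' n, p n * (if n < G then (0 : ℝ) else 1) = ∑' k, p (k + G) := by
    rw [← hse.sum_add_tsum_nat_add G]
    have h1 : ∑ n ∈ range G, p n * (if n < G then (0 : ℝ) else 1) = 0 :=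
      sum_eq_zero fun n hn => by rw [if_pos (mem_range.mp hn), mul_zero]
    rw [h1, zero_add]
    exact tsum_congr fun k => by rw [if_neg (by omega), mul_one]
  calc ∑' n, p n * (g n - g n₀) ^ 2
      ≤ ∑' n, (D ^ 2 * (p n * ((n : ℝ) - n₀) ^ 2) + p n * (if n < G then (0 : ℝ) else 1)) :=
        hsd.tsum_le_tsum hpt ((hsq.mul_left _).add hse)
    _ = D ^ 2 * ∑' n, p n * ((n : ℝ) - n₀) ^ 2 + ∑' k, p (k + G) := by
        rw [(hsq.mul_left _).tsum_add hse, tsum_mul_left, htail]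

/-- **The second moment about `c`**: `Σ p (n - c)² = V + (M - c)²` with `M = Σ p n`,
`V = Σ p n² - M²`. [folklore] -/
theorem tsum_mul_nat_sub_sq (hp : ∀ n, 0 ≤ p n) (hsum : HasSum p 1)
    (hrat : ∀ n, p (n + 1) * ((n : ℝ) + 1) = ν * g n * p n) (hg1 : ∀ n, g n ≤ 1) (hν : 0 < ν)
    (c : ℝ) :
    ∑' n, p n * ((n : ℝ) - c) ^ 2 =
      (∑' n, p n * (n : ℝ) ^ 2 - (∑' n, p n * (n : ℝ)) ^ 2) + (∑' n, p n * (n : ℝ) - c) ^ 2 := by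
  have hh : ∀ n : ℕ, |((n : ℕ) : ℝ)| ≤ 1 * ((n : ℝ) + 1) := fun n => by
    have hn0 : (0 : ℝ) ≤ n := Nat.cast_nonneg n
    rw [Nat.abs_cast]; linarith
  rw [tsum_mul_sub_sq hp hsum hrat hg1 hν (h := fun n => (n : ℝ)) hh c]; ring

/-- `E g ≤ 1`. [folklore] -/
theorem tsum_mul_g_le_one (hp : ∀ n, 0 ≤ p n) (hsum : HasSum p 1)
    (hrat : ∀ n, p (n + 1) * ((n : ℝ) + 1) = ν * g n * p n) (hg0 : ∀ n, 0 ≤ g n)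
    (hg1 : ∀ n, g n ≤ 1) (hν : 0 < ν) : ∑' n, p n * g n ≤ 1 := by
  have hsg : Summable fun n => p n * g n :=
    summable_mul_of_abs_le hp hrat hg1 hν (B := 1) fun n => by rw [abs_of_nonneg (hg0 n)]; exact hg1 n
  calc ∑' n, p n * g n ≤ ∑' n, p n := hsg.tsum_le_tsum (fun n => by nlinarith [hp n, hg1 n]) hsum.summable
    _ = 1 := hsum.tsum_eq

/-- `E g ≥ (1 - λ)(1 - tail)` if `g ≥ 1 - λ` on `[0, G]` (`λ ≤ 1`). [folklore] -/
theorem tsum_mul_g_ge (hp : ∀ n, 0 ≤ p n) (hsum : HasSum p 1)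
    (hrat : ∀ n, p (n + 1) * ((n : ℝ) + 1) = ν * g n * p n) (hg0 : ∀ n, 0 ≤ g n)
    (hg1 : ∀ n, g n ≤ 1) (hν : 0 < ν) {G : ℕ} {lam : ℝ} (hlam : lam ≤ 1)
    (hgl : ∀ n, n ≤ G → 1 - lam ≤ g n) :
    (1 - lam) * (1 - ∑' k, p (k + G)) ≤ ∑' n, p n * g n := by
  have h1 := (mean_ge hp hsum hrat hg0 hg1 hν hgl).1
  rw [tsum_mul_nat_eq hp hrat hg1 hν, mul_assoc] at h1
  have h2 : (1 - lam) * ∑ n ∈ range (G + 1), p n ≤ ∑' n, p n * g n := le_of_mul_le_mul_left h1 hν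
  refine le_trans ?_ h2
  refine mul_le_mul_of_nonneg_left ?_ (by linarith)
  have h3 := sum_add_tail hsum G
  rw [sum_range_succ]
  linarith [hp G]

/-- The arithmetic of the variance sandwich (all inputs are real numbers). [folklore] -/
theorem variance_arith {ν D lam V Eg Eg2 Egg T S2 : ℝ} (hν32 : 32 ≤ ν) (hlam : lam ≤ 1 / 2)
    (hD0 : 0 ≤ D) (hνD : ν * D ≤ 1 / 8) (hvar : V = ν ^ 2 * (Egg - Eg ^ 2) + ν * Eg) (hT0 : 0 ≤ T)
    (hν2T : ν ^ 2 * T ≤ 2) (hgg_le : Egg ≤ Eg2 + D + T) (hgg_ge : Eg2 - D - T ≤ Egg)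
    (hjensen : Eg ^ 2 ≤ Eg2) (hvg : Eg2 - Eg ^ 2 ≤ D ^ 2 * S2 + T) (hS2le : S2 ≤ V + 1)
    (hVnn : 0 ≤ V) (hEg1 : Eg ≤ 1) (hEg_ge : (1 - lam) * (1 - T) ≤ Eg) :
    ν / 4 ≤ V ∧ V ≤ 2 * ν := by
  have hν : 0 < ν := by linarith
  have hν2 : 0 ≤ ν ^ 2 := sq_nonneg ν
  have hνT0 : 0 ≤ ν * T := mul_nonneg hν.le hT0
  have hνT : ν * T ≤ 1 / 16 := by
    have h1 : ν * (ν * T) ≤ 2 := by rw [← mul_assoc, ← sq]; exact hν2T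
    have h2 : 32 * (ν * T) ≤ ν * (ν * T) :=
      mul_le_mul_of_nonneg_right hν32 hνT0
    linarith
  have hν2D : ν ^ 2 * D ≤ ν / 8 := by
    have h : ν ^ 2 * D = ν * (ν * D) := by ring
    rw [h]
    have h2 : ν * (ν * D) ≤ ν * (1 / 8) := mul_le_mul_of_nonneg_left hνD hν.le
    linarith
  have hν2D2 : ν ^ 2 * (D ^ 2 * (V + 1)) ≤ (1 / 64) * (V + 1) := by
    have h1 : (ν * D) ^ 2 ≤ (1 / 8) ^ 2 := pow_le_pow_left₀ (by positivity) hνD 2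
    have h2 : ν ^ 2 * (D ^ 2 * (V + 1)) = (ν * D) ^ 2 * (V + 1) := by ring
    rw [h2]
    have h3 : (ν * D) ^ 2 * (V + 1) ≤ (1 / 8) ^ 2 * (V + 1) := mul_le_mul_of_nonneg_right h1 (by linarith)
    linarith
  constructor
  · -- lower bound
    have h1 : ν ^ 2 * (-D - T) ≤ ν ^ 2 * (Egg - Eg ^ 2) :=
      mul_le_mul_of_nonneg_left (by linarith) hν2
    have h2 : ν * ((1 - lam) * (1 - T)) ≤ ν * Eg := mul_le_mul_of_nonneg_left hEg_ge hν.le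
    have hT1 : 0 ≤ 1 - T := by nlinarith
    have h3 : (1 / 2) * (1 - T) ≤ (1 - lam) * (1 - T) := mul_le_mul_of_nonneg_right (by linarith) hT1
    have h4 : ν * ((1 / 2) * (1 - T)) ≤ ν * ((1 - lam) * (1 - T)) := mul_le_mul_of_nonneg_left h3 hν.le
    have h5 : ν * ((1 / 2) * (1 - T)) = ν / 2 - ν * T / 2 := by ring
    have h6 : ν ^ 2 * (-D - T) = -(ν ^ 2 * D) - ν ^ 2 * T := by ring
    linarith
  · -- upper bound
    have h0 : D ^ 2 * S2 ≤ D ^ 2 * (V + 1) := mul_le_mul_of_nonneg_left hS2le (sq_nonneg D)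
    have h1 : ν ^ 2 * (Egg - Eg ^ 2) ≤ ν ^ 2 * (D ^ 2 * (V + 1) + T + D + T) :=
      mul_le_mul_of_nonneg_left (by linarith) hν2
    have h2 : ν * Eg ≤ ν * 1 := mul_le_mul_of_nonneg_left hEg1 hν.le
    have h3 : ν ^ 2 * (D ^ 2 * (V + 1) + T + D + T) =
        ν ^ 2 * (D ^ 2 * (V + 1)) + 2 * (ν ^ 2 * T) + ν ^ 2 * D := by ring
    linarith

/-- **COUNT FAMILIES: TWO-SIDED LINEAR VARIANCE** (registered helper `countFamily_variance` of the line
`susceptibility-variance-continuity`; part (b) of `stub_countLCLT` in abstract form). For a probability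
weight `p` on `ℕ` with `(n+1) p(n+1) = ν g(n) p(n)`, `0 ≤ g ≤ 1`, whose insertion probabilities satisfy
`g ≥ 1 - λ ≥ 1/2` and `|g(n+1) - g(n)| ≤ D` on `[0, G]`, with `ν ≥ 32`, `G ≥ 4ν + 3`, `ν D ≤ 1/8`:
`ν/4 ≤ Σ p n² - (Σ p n)² ≤ 2ν`. [folklore] -/
theorem countFamily_variance :
    ∀ (p g : ℕ → ℝ) (ν lam D : ℝ) (G : ℕ),
      (∀ n, 0 ≤ p n) → HasSum p 1 → (∀ n, p (n + 1) * ((n : ℝ) + 1) = ν * g n * p n) →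
      (∀ n, 0 ≤ g n) → (∀ n, g n ≤ 1) → 32 ≤ ν → 4 * ν + 3 ≤ (G : ℝ) →
      lam ≤ 1 / 2 → (∀ n, n ≤ G → 1 - lam ≤ g n) →
      0 ≤ D → (∀ n, n < G → |g (n + 1) - g n| ≤ D) → ν * D ≤ 1 / 8 →
      ν / 4 ≤ ∑' n, p n * (n : ℝ) ^ 2 - (∑' n, p n * (n : ℝ)) ^ 2 ∧
        ∑' n, p n * (n : ℝ) ^ 2 - (∑' n, p n * (n : ℝ)) ^ 2 ≤ 2 * ν := by
  intro p g ν lam D G hp hsum hrat hg0 hg1 hν32 hG hlam hgl hD0 hD hνD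
  have hν : 0 < ν := by linarith
  have hν1 : 1 ≤ ν := by linarith
  have hT : ∑' k, p (k + G) ≤ 2 / ν ^ 2 := tail_le_of_ge hp hsum hrat hg1 hν1 hG
  have hT0 : 0 ≤ ∑' k, p (k + G) := tsum_nonneg fun k => hp _
  have hν2T : ν ^ 2 * ∑' k, p (k + G) ≤ 2 := by
    have h := mul_le_mul_of_nonneg_left hT (sq_nonneg ν)
    rwa [mul_div_cancel₀ _ (by positivity)] at h
  have hMle : ∑' n, p n * (n : ℝ) ≤ ν := mean_le hp hsum hrat hg0 hg1 hν
  have hM0 : 0 ≤ ∑' n, p n * (n : ℝ) := tsum_nonneg fun n => mul_nonneg (hp n) (Nat.cast_nonneg n)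
  -- the reference integer `n₀ = ⌊M⌋₊ ≤ G`
  obtain ⟨n₀, hn₀M, hMn₀⟩ : ∃ n₀ : ℕ, (n₀ : ℝ) ≤ ∑' n, p n * (n : ℝ) ∧ ∑' n, p n * (n : ℝ) < n₀ + 1 :=
    ⟨⌊∑' n, p n * (n : ℝ)⌋₊, Nat.floor_le hM0, Nat.lt_floor_add_one _⟩
  have hn₀G : n₀ ≤ G := by
    have h : (n₀ : ℝ) ≤ G := by linarith
    exact_mod_cast h
  have hS2 := tsum_mul_nat_sub_sq hp hsum hrat hg1 hν (n₀ : ℝ)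
  have hVnn : 0 ≤ ∑' n, p n * (n : ℝ) ^ 2 - (∑' n, p n * (n : ℝ)) ^ 2 := by
    have h := tsum_mul_nat_sub_sq hp hsum hrat hg1 hν (∑' n, p n * (n : ℝ))
    have h0 : 0 ≤ ∑' n, p n * ((n : ℝ) - ∑' k, p k * (k : ℝ)) ^ 2 :=
      tsum_nonneg fun n => mul_nonneg (hp n) (sq_nonneg _)
    rw [h, sub_self] at h0
    simpa using h0
  have hS2le : ∑' n, p n * ((n : ℝ) - n₀) ^ 2 ≤
      (∑' n, p n * (n : ℝ) ^ 2 - (∑' n, p n * (n : ℝ)) ^ 2) + 1 := by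
    rw [hS2]
    have : (∑' n, p n * (n : ℝ) - n₀) ^ 2 ≤ 1 := by
      have h1 : |∑' n, p n * (n : ℝ) - n₀| ≤ 1 := by rw [abs_le]; constructor <;> linarith
      calc (∑' n, p n * (n : ℝ) - n₀) ^ 2 = |∑' n, p n * (n : ℝ) - n₀| ^ 2 := (sq_abs _).symm
        _ ≤ 1 ^ 2 := pow_le_pow_left₀ (abs_nonneg _) h1 2
        _ = 1 := one_pow 2
    linarith
  exact variance_arith hν32 hlam hD0 hνD (var_eq hp hrat hg1 hν) hT0 hν2T
    (tsum_gg_le hp hsum hrat hg0 hg1 hν hD0 hD) (tsum_gg_ge hp hsum hrat hg0 hg1 hν hD0 hD)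
    (sq_tsum_le hp hsum hrat hg0 hg1 hν) (tsum_g_sq_sub_le hp hsum hrat hg0 hg1 hν hD hn₀G) hS2le hVnn
    (tsum_mul_g_le_one hp hsum hrat hg0 hg1 hν) (tsum_mul_g_ge hp hsum hrat hg0 hg1 hν (by linarith) hgl)

end

end Summit.AtomisticToContinuum.HydrodynamicLimit.Theorems.LightConeInLawSVC.CountLCLT
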